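import Summits.BirchSwinnertonDyer.BirchSwinnertonDyer.Theorems.ByReductionTypeAtTwoAdditiveKatoTransportPrintExactAnyImageDoors
import Summits.BirchSwinnertonDyer.BirchSwinnertonDyer.Theorems.ByReductionTypeAtTwoAdditiveKatoTransportPrintExactAnyImageTorsion
import Literature.NumberTheory.EllipticCurves.Kato2004.DivisibilityInputsSplitTwistDescentTransportProofs
import Literature.NumberTheory.EllipticCurves.FineSelmerLimThm35AtTwoUpstairsProofs
import Literature.NumberTheory.GaloisRepresentations.OddAbsolutelyIrreducibleProofs
import Literature.NumberTheory.EllipticCurves.PAdicLFunctionIntegralityAtTwoProofs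
import HarnessLib

/-!
# Route ByReductionTypeAtTwo, crux C4″ `AdditivePotMultOverKAtTwo` (stmt-BirchSwinnertonDyer-22618; parent
# `AdditiveRankZeroAtTwo` 19098) — the split-twist block doors RE-KEYED from the Summits `@[conjecture]` constant to the
# Literature CONSTRUCTION fact `Kato2004.exists_splitTwistDivisibilityInputsDescent_negOne_two` (odd-branch descent package):
# base doors (key `γ⁻¹` ideal/length form, key `γ`), torsion doors, and the normalisation `κ_cyc(γ) = 5` (theorems only)

Cell `bsd-2adic` (run/shared/lean/pub/bsd-2adic/), seat `bsd-2adic-addL2x` GEN 17 (explicit unit; crux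
stmt-BirchSwinnertonDyer-19098, child C4″ stmt-BirchSwinnertonDyer-22618). FIELD FOR FIELD the (−1)-block doors of
`…PrintExactAnyImageDoors.lean` §1–§2 (seat k4-w3 GEN 4) and the torsion doors of `…PrintExactAnyImageTorsion.lean` §1
(k4-w3 GEN 5), with ONE change of input: the hypothesis
`hPE : KatoOddBranchInputsAtTwoNegOneSplitTwistPrintExactAnyImage` (a Summits-side `@[conjecture]` constant: an INJECTIVE
odd-branch Coleman map at `2`, «beyond print like Kobayashi 2006 Thm. 4.1 at 2») is replaced by
`hDesc : Kato2004.exists_splitTwistDivisibilityInputsDescent_negOne_two` — the Literature CONSTRUCTION fact of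
`Literature/…/Kato2004/DivisibilityInputsSplitTwistDescent.lean` (this seat, GEN 17): the §17.13 package of the additive `W`
presented over Kato's tower `ℚ(ζ_{2^∞})` for the newform of `W^{(−1)}` by the printed objects of the proof of Lemma 17.12 at
`T″(k−1) = ℤ₂` (the SAME objects as the multiplicative lane's review-accepted `exists_multDivisibilityInputsDescent_split`,
p495896) and DESCENDED on the odd branch, whose Coleman map `[m] ↦ pr⁻(𝔏_η(θ·m))` has kernel killed by `2θ`, `θ = 5T + 4`
(KERNEL: `Kato2004.SplitTwistDivisibilityInputsDescent.col_ker`). The END statements the doors need —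
`ℓ_𝔮(X(W/ℚ_∞)) ≤ ℓ_𝔮(Λ/(L̃))` off `(θ)` and, by transport, at `(θ)`; `X` torsion — are the Literature theorems
`….lengthAt_X_le_off_theta`, `….lengthAt_X_le_at_theta_of_transport/_of_lengthAt_symm`, `….isTorsion_X`
(`…SplitTwistDescentTransportProofs.lean`). The fact carries ONE extra binder versus the constant: the NORMALISATION
`κ_cyc(γ) = 5` of the generator (Kato's generator of `G¹_∞ = 1 + 4ℤ₂`; the tree's `IsCyclotomicVariable 2 γ` allows
`κ_cyc(γ) ∈ {±5}`). §0 supplies the bookkeeping that makes it harmless downstream: from `IsCyclotomicVariable 2 γ` either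
`κ_cyc(γ) = 5` or `κ_cyc(γ·c̃) = 5` for a complex conjugation `c̃ ∈ ker κ` (`χ₂(c̃) = −1`, tree theorem
`GaloisRep.cyclotomicCharacter_of_isComplexConjugation`; torsion of `ℤ₂ˣ` is `{±1}`), and `κ_cyc(γ) = 5 ⇒ γ·i = i`
(`GaloisRep.cyclotomicCharacter_spec`) — the binder `hγθ` of the model doors. The companion file
`…AdditiveKatoTransportDescentFinalDoors.lean` re-runs the Decomposition / Model / Print / Final levels of the chain.

Contents:
* §0 `cyclotomicGenerator_two`, `units_eq_one_or_neg_one_of_isOfFinOrder`, `cyclotomicCharacter_eq_five_or_eq_neg_five`,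
  `exists_mem_kerSubgroup_cyclotomicCharacter_eq_neg_one`, `exists_mem_kerSubgroup_cyclotomicCharacter_mul_eq_five`,
  `smul_eq_self_of_sq_eq_neg_one_of_cyclotomicCharacter_eq_five`.
* §1 (key `γ⁻¹`) `lengthAt_selmerDualContra_le_of_splitTwistDescent_fe` (ideal form of the `ι`-symmetry),
  `…_of_lengthAt_symm_fe` (length form) — twins of `…PrintExactAnyImage_fe` / `…_of_lengthAt_symm_fe`.
* §2 (key `γ`) `lengthAt_selmerDual_le_of_splitTwistDescent_fe` — twin of `…PrintExactAnyImage_fe` (key `γ`).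
* §3 torsion: `isTorsion_selmerDualContra_of_splitTwistDescent{,_of_doorMultiple}`,
  `isTorsion_selmerDual_of_splitTwistDescent{,_of_doorMultiple,_of_isIsogenous}`.

HONEST FRAMING (D-0036 / D-0054): theorems only — no definition, no named fact, no instance, no `sorry`; route-independent;
CONDITIONAL on `Kato2004.thm12_4` (PRINT) and on the Literature construction fact
`Kato2004.exists_splitTwistDivisibilityInputsDescent_negOne_two` (every field a printed statement for the Tate curve at `2` or one
of the sibling's two review-accepted bridges, plus the cell's twist dictionary T20 (a); D-0026 debt +1, review lane), BY NAME;
types-the-object-of (the ONE typed input at `2` of all four split-twist sub-blocks of C4″ moves from a Summits `@[conjecture]`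
constant to a Literature-located construction fact on K11b's footing); closes none; nothing booked; BSD is not proved by any
of this. PARTITION: X5@2 additive potentially-multiplicative block, the (−1)/(−2)-split sub-blocks (169 + 39 classes) × `p = 2`.

References: [Kato2004Asterisque] Thm. 12.4 (p. 221), Thm. 12.5 (3) with (12.5.1) (p. 222), §16 (pp. 268–271), Lemma 17.12
(pp. 278–279), Thm. 17.4 (1) (p. 273), §17.13 (pp. 279–280); [GreenbergLNM1716] §1 (p. 60), Thm. 1.14 (p. 68);
[Greenberg1989] pp. 101–102; [MazurTateTeitelbaum1986Invent] §I.13, §I.17; [Washington1997] §13.1; [SerreAbelianLadic1968] I §1.2;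
memo `run/shared/lean/pub/bsd-2adic/addL2x/VERDICT-19098-addL2x-GEN17.md`.
-/

set_option autoImplicit false
-- the summit's namespace `Summit.BirchSwinnertonDyer.BirchSwinnertonDyer` (Sub = Summit) trips `dupNamespace`
set_option linter.dupNamespace false

noncomputable section

open scoped Classical MatrixGroups ModularForm

open Field CongruenceSubgroup WeierstrassCurve Literature.NumberTheory.EllipticCurves
  Literature.NumberTheory.EllipticCurves.ModularForms Literature.NumberTheory.EllipticCurves.IwasawaAlgebra
  Literature.NumberTheory.EllipticCurves.Module Literature.NumberTheory.GaloisRepresentations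

namespace Summit.BirchSwinnertonDyer.BirchSwinnertonDyer.Theorems.AddKatoTwo

/-! ## §0 The normalisation `κ_cyc(γ) = 5` -/

/-- **The torsion of `ℤ₂ˣ` is `{±1}`**: a unit of `ℤ₂` of finite order is `1` or `−1`
(`FineSelmerUpstairs.units_eq_one_or_eq_neg_one_of_mem_torsion_two`). [cite: Washington1997, §13.1] -/
theorem units_eq_one_or_neg_one_of_isOfFinOrder {ζ : ℤ_[2]ˣ} (hζ : IsOfFinOrder ζ) : ζ = 1 ∨ ζ = -1 :=
  FineSelmerUpstairs.units_eq_one_or_eq_neg_one_of_mem_torsion_two ((CommGroup.mem_torsion _).mpr hζ)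

/-- **At `p = 2`, `IsCyclotomicVariable 2 γ` means `κ_cyc(γ) = 5` or `κ_cyc(γ) = −5`** (`κ_cyc(γ)·ζ = 5` with `ζ ∈ μ(ℤ₂) = {±1}`).
[cite: MazurTateTeitelbaum1986Invent, §I.13 (p = 2: Δ = {±1}, γ = 5)] -/
theorem cyclotomicCharacter_eq_five_or_eq_neg_five {γ : absoluteGaloisGroup ℚ} (hγ' : IsCyclotomicVariable 2 γ) :
    ((GaloisRep.cyclotomicCharacter ℚ 2 γ : ℤ_[2]ˣ) : ℤ_[2]) = 5 ∨
      ((GaloisRep.cyclotomicCharacter ℚ 2 γ : ℤ_[2]ˣ) : ℤ_[2]) = -5 := by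
  obtain ⟨ζ, hζ, h⟩ := hγ'
  rw [cyclotomicGenerator_two, Units.val_mul] at h
  push_cast at h
  rcases units_eq_one_or_neg_one_of_isOfFinOrder hζ with rfl | rfl
  · left; simpa using h
  · right
    rw [Units.val_neg, Units.val_one, mul_neg, mul_one] at h
    rw [← h, neg_neg]

/-- **A complex conjugation lies in `ker κ` and has `κ_cyc(c̃) = −1`**, for ANY `ℤ₂`-extension `κ` of `ℚ` (`c̃² = 1` and `ℤ₂` is
torsion free; `χ₂(c̃) = −1` is the tree theorem `GaloisRep.cyclotomicCharacter_of_isComplexConjugation`).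
[cite: Washington1997, §13.1] [cite: SerreAbelianLadic1968, Ch. I §1.2] -/
theorem exists_mem_kerSubgroup_cyclotomicCharacter_eq_neg_one (κ : ZpExtension ℚ 2) :
    ∃ c : absoluteGaloisGroup ℚ, c ∈ κ.kerSubgroup ∧ ((GaloisRep.cyclotomicCharacter ℚ 2 c : ℤ_[2]ˣ) : ℤ_[2]) = -1 := by
  obtain ⟨c, hc⟩ := exists_isComplexConjugation (Rat.castHom ℝ)
  refine ⟨c, ?_, GaloisRep.cyclotomicCharacter_of_isComplexConjugation 2 hc⟩
  -- `c² = 1`, `ℤ₂` torsion-free (adapted from `AddKatoTwoQuadLayer.exists_mem_kerSubgroup_smul_sqrt_eq_neg_of_neg`)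
  rw [ZpExtension.mem_kerSubgroup]
  have h2 : orderOf c = 2 := hc.orderOf_eq_two
  have hcc : c * c = 1 := by rw [← pow_two, ← h2, pow_orderOf_eq_one]
  have hκ : κ c * κ c = 1 := by rw [← map_mul, hcc, map_one]
  have hadd : (κ c).toAdd + (κ c).toAdd = 0 := by
    rw [← toAdd_mul, hκ, toAdd_one]
  have h0 : (κ c).toAdd = 0 := by
    rw [← two_mul] at hadd
    rcases mul_eq_zero.mp hadd with h | h
    · exfalso
      have h2' : (2 : ℤ_[2]) = ((2 : ℕ) : ℤ_[2]) := by norm_num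
      rw [h2'] at h
      exact (Nat.cast_ne_zero.mpr (by norm_num : (2 : ℕ) ≠ 0)) h
    · exact h
  exact Multiplicative.toAdd.injective (by rw [h0, toAdd_one])

/-- **WLOG `κ_cyc(γ) = 5`**: if `γ` matches the cyclotomic variable at `2` then `κ_cyc(γ·c) = 5` for some `c ∈ ker κ`
(`c = 1` if `κ_cyc(γ) = 5`, a complex conjugation if `κ_cyc(γ) = −5`). Every `ℚ_∞`-object sees `γ` and `γ·c` alike
(`SelmerDualData.rekey`). [cite: Washington1997, §13.1] [cite: MazurTateTeitelbaum1986Invent, §I.13] -/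
theorem exists_mem_kerSubgroup_cyclotomicCharacter_mul_eq_five (κ : ZpExtension ℚ 2) {γ : absoluteGaloisGroup ℚ}
    (hγ' : IsCyclotomicVariable 2 γ) :
    ∃ c : absoluteGaloisGroup ℚ, c ∈ κ.kerSubgroup ∧
      ((GaloisRep.cyclotomicCharacter ℚ 2 (γ * c) : ℤ_[2]ˣ) : ℤ_[2]) = (cyclotomicGenerator 2 : ℤ_[2]) := by
  rw [cyclotomicGenerator_two]
  push_cast
  rcases cyclotomicCharacter_eq_five_or_eq_neg_five hγ' with h | h
  · exact ⟨1, one_mem _, by rw [mul_one, h]⟩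
  · obtain ⟨c, hc, hχc⟩ := exists_mem_kerSubgroup_cyclotomicCharacter_eq_neg_one κ
    refine ⟨c, hc, ?_⟩
    rw [map_mul, Units.val_mul, h, hχc]
    norm_num

/-- **`κ_cyc(γ) = 5 ⇒ γ` fixes `√−1`**: `i⁴ = 1`, so `γ·i = i^{κ_cyc(γ) mod 4} = i` (`GaloisRep.cyclotomicCharacter_spec`). This is
the binder `hγθ` of the model doors (`…PrintExactAnyImageModelDoors`). [cite: SerreAbelianLadic1968, Ch. I §1.2] -/
theorem smul_eq_self_of_sq_eq_neg_one_of_cyclotomicCharacter_eq_five {γ : absoluteGaloisGroup ℚ}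
    (hγ5 : ((GaloisRep.cyclotomicCharacter ℚ 2 γ : ℤ_[2]ˣ) : ℤ_[2]) = (cyclotomicGenerator 2 : ℤ_[2]))
    {θ : AlgebraicClosure ℚ} (hθ : θ ^ 2 = algebraMap ℚ (AlgebraicClosure ℚ) (-1)) : γ • θ = θ := by
  haveI : Fact (Nat.Prime 2) := ⟨Nat.prime_two⟩
  have hθ4 : θ ^ 2 ^ 2 = 1 := by
    rw [show (2 : ℕ) ^ 2 = 2 * 2 by norm_num, pow_mul, hθ, map_neg, map_one]; norm_num
  have h := GaloisRep.cyclotomicCharacter_spec ℚ 2 (k := 2) γ θ hθ4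
  rw [cyclotomicGenerator_two] at hγ5
  push_cast at hγ5
  have h5 : (((GaloisRep.cyclotomicCharacter ℚ 2 γ : ℤ_[2]ˣ) : ℤ_[2]).toZModPow 2).val = 1 := by
    rw [hγ5, map_ofNat]; decide
  rw [h5, pow_one] at h
  exact h

/-! ## §1 The (−1)-block, key `γ⁻¹` (the natural = print-exact datum) -/

/-- **`ℓ_𝔮(X') ≤ ℓ_𝔮(Λ/(L̃))` at EVERY height-one `𝔮 ∌ 2` for the key-`γ⁻¹` dual Selmer datum `D'` of `W` (additive at `2`,
`W^{(−1)}` split multiplicative), `κ_cyc(γ) = 5`, functional equation in the kernel**, from: `Kato2004.thm12_4` (PRINT), the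
Literature construction fact `Kato2004.exists_splitTwistDivisibilityInputsDescent_negOne_two`, finite generation of `D'.X`, the
symmetry `ι(char D'.X) = char D'.X` (used only at `𝔮 ∋ 5T+4`) and an integral multiple `L̃ = 2^m L⁻ ≠ 0` of the odd branch.
Off `(5T+4)` the package alone (`….lengthAt_X_le_off_theta`); at it, transport from `ι(5T+4) ≐ (T−4)`
(`….lengthAt_X_le_at_theta_of_transport`). Twin of `lengthAt_selmerDualContra_le_of_oddBranchInputsPrintExactAnyImage_fe`.
[cite: Kato2004Asterisque, Thm. 12.4 (2) (p. 221), Thm. 12.5 (3) and (12.5.1) (p. 222), Conj. 17.6 (p. 274), §17.13 (pp. 279–280)]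
[cite: GreenbergLNM1716, Thm. 1.14 (p. 68)] [cite: MazurTateTeitelbaum1986Invent, §I.17] -/
theorem lengthAt_selmerDualContra_le_of_splitTwistDescent_fe (h12 : Kato2004.thm12_4)
    (hDesc : Kato2004.exists_splitTwistDivisibilityInputsDescent_negOne_two)
    (W : WeierstrassCurve ℚ) [W.IsElliptic] [W.IsGloballyMinimal] [ContinuousSMul ℤ_[2] (W.tateModule 2)]
    {N : ℕ} [NeZero N] (f : CuspForm (Gamma0 N) 2) (κ : ZpExtension ℚ 2) (γ : absoluteGaloisGroup ℚ)
    (hsp : (W.quadraticTwist (-1)).HasSplitMultiplicativeReductionAtPrime 2)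
    (hκ : κ.IsCyclotomic) (hγ : κ.IsTopGenerator γ)
    (hγ5 : ((GaloisRep.cyclotomicCharacter ℚ 2 γ : ℤ_[2]ˣ) : ℤ_[2]) = (cyclotomicGenerator 2 : ℤ_[2]))
    (hf : IsNewformOf (W.quadraticTwist (-1)) f) (I : Kato2004.IwasawaH1Data W 2 κ γ)
    (D' : W.SelmerDualData κ γ⁻¹) [Module.Finite (IwasawaAlgebra 2) D'.X]
    (hXι : (charIdeal (IwasawaAlgebra 2) D'.X).map (invol 2).toRingHom = charIdeal (IwasawaAlgebra 2) D'.X)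
    (Lt : IwasawaAlgebra 2) (m : ℕ)
    (hLt : iwasawaToPowerSeries 2 Lt =
      PowerSeries.C ((2 : ℚ_[2]) ^ m) * padicLFunctionMinusBranchMult f (1 : ℚ_[2]) 1)
    (hLt0 : Lt ≠ 0)
    (𝔮 : PrimeSpectrum (IwasawaAlgebra 2)) (h𝔮 : 𝔮.asIdeal.height = 1)
    (hp𝔮 : PowerSeries.C (2 : ℤ_[2]) ∉ 𝔮.asIdeal) :
    lengthAt (IwasawaAlgebra 2) D'.X 𝔮 ≤
      lengthAt (IwasawaAlgebra 2) (IwasawaAlgebra 2 ⧸ Ideal.span {Lt}) 𝔮 := by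
  haveI : Fact (Nat.Prime 2) := ⟨Nat.prime_two⟩
  obtain ⟨K⟩ := hDesc W f κ γ hsp hκ hγ hγ5 hf I D'
  have hLtι : (Ideal.span {Lt}).map (invol 2).toRingHom = Ideal.span {Lt} :=
    MultOddBranchFE.map_invol_span_eq_of_eq_oddBranchMult_two_of_split hsp hf hLt
  have hp2 : ((2 : ℕ) : ℚ_[2]) = (2 : ℚ_[2]) := by norm_num
  have hLt' : iwasawaToPowerSeries 2 Lt =
      PowerSeries.C (((2 : ℕ) : ℚ_[2]) ^ m) * padicLFunctionMinusBranchMult f (1 : ℚ_[2]) 1 := by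
    rw [hp2]; exact hLt
  have hp𝔮' : PowerSeries.C ((2 : ℕ) : ℤ_[2]) ∉ 𝔮.asIdeal := by exact_mod_cast hp𝔮
  rcases not_mem_comap_invol_of_mem_five_X_add_four 𝔮 hp𝔮 with hoff | hat
  · exact K.lengthAt_X_le_off_theta h12 hκ hγ hLt' hLt0 𝔮 h𝔮 hp𝔮' hoff
  · exact K.lengthAt_X_le_at_theta_of_transport h12 hκ hγ hLt' hLt0 𝔮 h𝔮 hp𝔮' hat hXι hLtι

/-- The LENGTH-form variant of `lengthAt_selmerDualContra_le_of_splitTwistDescent_fe` at one prime pair: with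
`ℓ_{𝔮}(D'.X) = ℓ_{ι𝔮}(D'.X)` instead of the ideal form; finite generation of `D'.X` not needed. Twin of
`lengthAt_selmerDualContra_le_of_oddBranchInputsPrintExactAnyImage_of_lengthAt_symm_fe`.
[cite: Kato2004Asterisque, Thm. 12.5 (3) and (12.5.1) (p. 222), §17.13 (pp. 279–280)] [cite: GreenbergLNM1716, Thm. 1.14 (p. 68)]
[cite: MazurTateTeitelbaum1986Invent, §I.17] -/
theorem lengthAt_selmerDualContra_le_of_splitTwistDescent_of_lengthAt_symm_fe (h12 : Kato2004.thm12_4)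
    (hDesc : Kato2004.exists_splitTwistDivisibilityInputsDescent_negOne_two)
    (W : WeierstrassCurve ℚ) [W.IsElliptic] [W.IsGloballyMinimal] [ContinuousSMul ℤ_[2] (W.tateModule 2)]
    {N : ℕ} [NeZero N] (f : CuspForm (Gamma0 N) 2) (κ : ZpExtension ℚ 2) (γ : absoluteGaloisGroup ℚ)
    (hsp : (W.quadraticTwist (-1)).HasSplitMultiplicativeReductionAtPrime 2)
    (hκ : κ.IsCyclotomic) (hγ : κ.IsTopGenerator γ)
    (hγ5 : ((GaloisRep.cyclotomicCharacter ℚ 2 γ : ℤ_[2]ˣ) : ℤ_[2]) = (cyclotomicGenerator 2 : ℤ_[2]))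
    (hf : IsNewformOf (W.quadraticTwist (-1)) f) (I : Kato2004.IwasawaH1Data W 2 κ γ)
    (D' : W.SelmerDualData κ γ⁻¹) (Lt : IwasawaAlgebra 2) (m : ℕ)
    (hLt : iwasawaToPowerSeries 2 Lt =
      PowerSeries.C ((2 : ℚ_[2]) ^ m) * padicLFunctionMinusBranchMult f (1 : ℚ_[2]) 1)
    (hLt0 : Lt ≠ 0)
    (𝔮 : PrimeSpectrum (IwasawaAlgebra 2)) (h𝔮 : 𝔮.asIdeal.height = 1)
    (hp𝔮 : PowerSeries.C (2 : ℤ_[2]) ∉ 𝔮.asIdeal)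
    (hXsym : lengthAt (IwasawaAlgebra 2) D'.X 𝔮 =
      lengthAt (IwasawaAlgebra 2) D'.X (PrimeSpectrum.comap (invol 2).toRingHom 𝔮)) :
    lengthAt (IwasawaAlgebra 2) D'.X 𝔮 ≤
      lengthAt (IwasawaAlgebra 2) (IwasawaAlgebra 2 ⧸ Ideal.span {Lt}) 𝔮 := by
  haveI : Fact (Nat.Prime 2) := ⟨Nat.prime_two⟩
  obtain ⟨K⟩ := hDesc W f κ γ hsp hκ hγ hγ5 hf I D'
  have hLtι : (Ideal.span {Lt}).map (invol 2).toRingHom = Ideal.span {Lt} :=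
    MultOddBranchFE.map_invol_span_eq_of_eq_oddBranchMult_two_of_split hsp hf hLt
  have hp2 : ((2 : ℕ) : ℚ_[2]) = (2 : ℚ_[2]) := by norm_num
  have hLt' : iwasawaToPowerSeries 2 Lt =
      PowerSeries.C (((2 : ℕ) : ℚ_[2]) ^ m) * padicLFunctionMinusBranchMult f (1 : ℚ_[2]) 1 := by
    rw [hp2]; exact hLt
  have hp𝔮' : PowerSeries.C ((2 : ℕ) : ℤ_[2]) ∉ 𝔮.asIdeal := by exact_mod_cast hp𝔮
  rcases not_mem_comap_invol_of_mem_five_X_add_four 𝔮 hp𝔮 with hoff | hat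
  · exact K.lengthAt_X_le_off_theta h12 hκ hγ hLt' hLt0 𝔮 h𝔮 hp𝔮' hoff
  · exact K.lengthAt_X_le_at_theta_of_lengthAt_symm h12 hκ hγ hLt' hLt0 𝔮 h𝔮 hp𝔮' hat hXsym hLtι


/-! ## §2 The (−1)-block, key `γ` (the tree's dual Selmer datum) -/

/-- **`ℓ_𝔮(X(W/ℚ_∞)) ≤ ℓ_𝔮(Λ/(L̃))` at EVERY height-one `𝔮 ∌ 2` for the KEY-`γ` dual Selmer datum of `W` (additive at `2`,
`W^{(−1)}` split multiplicative), `κ_cyc(γ) = 5`, functional equation in the kernel**, from the Literature construction fact,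
`Kato2004.thm12_4`, `ι(char D.X) = char D.X` and `L̃ = 2^m L⁻ ≠ 0`: twist `D` to a key-`γ⁻¹` datum
(`Kato2004.selmerDualData_exists_involTwist`), apply §1 at `ι𝔮`, transport back (`ℓ_𝔮(D.X) = ℓ_{ι𝔮}(D'.X)`, `(ι L̃) = (L̃)`).
Twin of `lengthAt_selmerDual_le_of_oddBranchInputsPrintExactAnyImage_fe`.
[cite: Kato2004Asterisque, Thm. 12.4 (2) (p. 221), Thm. 12.5 (3) and (12.5.1) (p. 222), §17.3 (p. 273), §17.13 (pp. 279–280)]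
[cite: Greenberg1989, pp. 101–102 (S^ι)] [cite: GreenbergLNM1716, Thm. 1.14 (p. 68)] [cite: MazurTateTeitelbaum1986Invent, §I.17] -/
theorem lengthAt_selmerDual_le_of_splitTwistDescent_fe (h12 : Kato2004.thm12_4)
    (hDesc : Kato2004.exists_splitTwistDivisibilityInputsDescent_negOne_two)
    (W : WeierstrassCurve ℚ) [W.IsElliptic] [W.IsGloballyMinimal] [ContinuousSMul ℤ_[2] (W.tateModule 2)]
    {N : ℕ} [NeZero N] (f : CuspForm (Gamma0 N) 2) (κ : ZpExtension ℚ 2) (γ : absoluteGaloisGroup ℚ)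
    (hsp : (W.quadraticTwist (-1)).HasSplitMultiplicativeReductionAtPrime 2)
    (hκ : κ.IsCyclotomic) (hγ : κ.IsTopGenerator γ)
    (hγ5 : ((GaloisRep.cyclotomicCharacter ℚ 2 γ : ℤ_[2]ˣ) : ℤ_[2]) = (cyclotomicGenerator 2 : ℤ_[2]))
    (hf : IsNewformOf (W.quadraticTwist (-1)) f)
    (I : Kato2004.IwasawaH1Data W 2 κ γ) (D : W.SelmerDualData κ γ) [Module.Finite (IwasawaAlgebra 2) D.X]
    (hXι : (charIdeal (IwasawaAlgebra 2) D.X).map (invol 2).toRingHom = charIdeal (IwasawaAlgebra 2) D.X)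
    (Lt : IwasawaAlgebra 2) (m : ℕ)
    (hLt : iwasawaToPowerSeries 2 Lt =
      PowerSeries.C ((2 : ℚ_[2]) ^ m) * padicLFunctionMinusBranchMult f (1 : ℚ_[2]) 1)
    (hLt0 : Lt ≠ 0)
    (𝔮 : PrimeSpectrum (IwasawaAlgebra 2)) (h𝔮 : 𝔮.asIdeal.height = 1)
    (hp𝔮 : PowerSeries.C (2 : ℤ_[2]) ∉ 𝔮.asIdeal) :
    lengthAt (IwasawaAlgebra 2) D.X 𝔮 ≤
      lengthAt (IwasawaAlgebra 2) (IwasawaAlgebra 2 ⧸ Ideal.span {Lt}) 𝔮 := by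
  haveI : Fact (Nat.Prime 2) := ⟨Nat.prime_two⟩
  have hLtι : (Ideal.span {Lt}).map (invol 2).toRingHom = Ideal.span {Lt} :=
    MultOddBranchFE.map_invol_span_eq_of_eq_oddBranchMult_two_of_split hsp hf hLt
  -- the key-`γ⁻¹` twist of `D`
  obtain ⟨D', e, he, -⟩ := Kato2004.selmerDualData_exists_involTwist (mul_inv_cancel γ) D
  haveI : Module.Finite (IwasawaAlgebra 2) D'.X := Kato2004.selmerDualData_finite_inv D D'
  have hX'ι : (charIdeal (IwasawaAlgebra 2) D'.X).map (invol 2).toRingHom = charIdeal (IwasawaAlgebra 2) D'.X :=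
    (Kato2004.selmerDualData_map_invol_charIdeal_iff_inv D D').mp hXι
  -- the conjugate prime
  set 𝔮' := PrimeSpectrum.comap (invol 2).toRingHom 𝔮 with h𝔮'def
  have h𝔮' : 𝔮'.asIdeal.height = 1 := by rw [h𝔮'def, Kato2004.height_comap_invol]; exact h𝔮
  have hp𝔮' : PowerSeries.C (2 : ℤ_[2]) ∉ 𝔮'.asIdeal := by
    intro h
    apply hp𝔮
    rw [h𝔮'def, PrimeSpectrum.comap_asIdeal, Ideal.mem_comap] at h
    change invol 2 (PowerSeries.C (2 : ℤ_[2])) ∈ 𝔮.asIdeal at h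
    rwa [invol_C] at h
  -- the key-`γ⁻¹` door at `ι𝔮`
  have hA := lengthAt_selmerDualContra_le_of_splitTwistDescent_fe h12 hDesc W f κ γ hsp hκ hγ hγ5 hf I D' hX'ι Lt m hLt
    hLt0 𝔮' h𝔮' hp𝔮'
  -- transport back to key `γ` at `𝔮`
  rw [Kato2004.selmerDualData_lengthAt_eq_inv D D' 𝔮,
    Kato2004.lengthAt_quotient_span_eq_comap_invol_of_map_invol_span_eq hLtι 𝔮]
  exact hA

/-! ## §3 `X(W/ℚ_∞)` is torsion from the Literature fact -/

/-- **`X(W/ℚ_∞)` of key `γ⁻¹` is `Λ`-torsion for the additive (−1)-split-twist curve `W`, from the Literature fact and `L⁻ ≠ 0`**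
(Thm. 17.4 (1) at `2` read through the odd descent package: `Kato2004.SplitTwistDivisibilityInputsDescent.isTorsion_X`). Twin of
`isTorsion_selmerDualContra_of_oddBranchInputsPrintExactAnyImage`.
[cite: Kato2004Asterisque, Thm. 17.4 (1) (p. 273), §17.13 (pp. 279–280), 14.9 (p. 239), Thm. 12.4 (1) (p. 221)] -/
theorem isTorsion_selmerDualContra_of_splitTwistDescent
    (hDesc : Kato2004.exists_splitTwistDivisibilityInputsDescent_negOne_two)
    (W : WeierstrassCurve ℚ) [W.IsElliptic] [W.IsGloballyMinimal] [ContinuousSMul ℤ_[2] (W.tateModule 2)]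
    {N : ℕ} [NeZero N] (f : CuspForm (Gamma0 N) 2) (κ : ZpExtension ℚ 2) (γ : absoluteGaloisGroup ℚ)
    (hsp : (W.quadraticTwist (-1)).HasSplitMultiplicativeReductionAtPrime 2)
    (hκ : κ.IsCyclotomic) (hγ : κ.IsTopGenerator γ)
    (hγ5 : ((GaloisRep.cyclotomicCharacter ℚ 2 γ : ℤ_[2]ˣ) : ℤ_[2]) = (cyclotomicGenerator 2 : ℤ_[2]))
    (hf : IsNewformOf (W.quadraticTwist (-1)) f) (I : Kato2004.IwasawaH1Data W 2 κ γ)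
    (D' : W.SelmerDualData κ γ⁻¹)
    (hL : padicLFunctionMinusBranchMult f (1 : ℚ_[2]) 1 ≠ 0) : D'.IsTorsion := by
  haveI : Fact (Nat.Prime 2) := ⟨Nat.prime_two⟩
  obtain ⟨K⟩ := hDesc W f κ γ hsp hκ hγ hγ5 hf I D'
  exact K.isTorsion_X five_X_add_four_ne_zero hL

/-- Door-binder variant: an integral multiple `L̃ = 2^m·L⁻ ≠ 0` replaces `L⁻ ≠ 0`. Twin of
`isTorsion_selmerDualContra_of_oddBranchInputsPrintExactAnyImage_of_doorMultiple`.
[cite: Kato2004Asterisque, Thm. 17.4 (1) (p. 273), Thm. 16.2 (p. 269)] -/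
theorem isTorsion_selmerDualContra_of_splitTwistDescent_of_doorMultiple
    (hDesc : Kato2004.exists_splitTwistDivisibilityInputsDescent_negOne_two)
    (W : WeierstrassCurve ℚ) [W.IsElliptic] [W.IsGloballyMinimal] [ContinuousSMul ℤ_[2] (W.tateModule 2)]
    {N : ℕ} [NeZero N] (f : CuspForm (Gamma0 N) 2) (κ : ZpExtension ℚ 2) (γ : absoluteGaloisGroup ℚ)
    (hsp : (W.quadraticTwist (-1)).HasSplitMultiplicativeReductionAtPrime 2)
    (hκ : κ.IsCyclotomic) (hγ : κ.IsTopGenerator γ)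
    (hγ5 : ((GaloisRep.cyclotomicCharacter ℚ 2 γ : ℤ_[2]ˣ) : ℤ_[2]) = (cyclotomicGenerator 2 : ℤ_[2]))
    (hf : IsNewformOf (W.quadraticTwist (-1)) f) (I : Kato2004.IwasawaH1Data W 2 κ γ)
    (D' : W.SelmerDualData κ γ⁻¹)
    (Lt : IwasawaAlgebra 2) (m : ℕ)
    (hLt : iwasawaToPowerSeries 2 Lt = PowerSeries.C ((2 : ℚ_[2]) ^ m) * padicLFunctionMinusBranchMult f (1 : ℚ_[2]) 1)
    (hLt0 : Lt ≠ 0) : D'.IsTorsion := by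
  refine isTorsion_selmerDualContra_of_splitTwistDescent hDesc W f κ γ hsp hκ hγ hγ5 hf I D' fun h0 ↦ hLt0 ?_
  haveI : Fact (Nat.Prime 2) := ⟨Nat.prime_two⟩
  apply iwasawaToPowerSeries_injective 2
  rw [hLt, h0, mul_zero, map_zero]

/-- **`X(W/ℚ_∞)` of key `γ` is `Λ`-torsion** — the key-`γ⁻¹` statement at the `ι`-twist of `D`, carried back by
`selmerDualData_isTorsion_of_inv`. Twin of `isTorsion_selmerDual_of_oddBranchInputsPrintExactAnyImage`.
[cite: Kato2004Asterisque, Thm. 17.4 (1) (p. 273), §17.13 (pp. 279–280)] [cite: GreenbergLNM1716, §1 (p. 60)] -/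
theorem isTorsion_selmerDual_of_splitTwistDescent
    (hDesc : Kato2004.exists_splitTwistDivisibilityInputsDescent_negOne_two)
    (W : WeierstrassCurve ℚ) [W.IsElliptic] [W.IsGloballyMinimal] [ContinuousSMul ℤ_[2] (W.tateModule 2)]
    {N : ℕ} [NeZero N] (f : CuspForm (Gamma0 N) 2) (κ : ZpExtension ℚ 2) (γ : absoluteGaloisGroup ℚ)
    (hsp : (W.quadraticTwist (-1)).HasSplitMultiplicativeReductionAtPrime 2)
    (hκ : κ.IsCyclotomic) (hγ : κ.IsTopGenerator γ)
    (hγ5 : ((GaloisRep.cyclotomicCharacter ℚ 2 γ : ℤ_[2]ˣ) : ℤ_[2]) = (cyclotomicGenerator 2 : ℤ_[2]))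
    (hf : IsNewformOf (W.quadraticTwist (-1)) f) (I : Kato2004.IwasawaH1Data W 2 κ γ)
    (D : W.SelmerDualData κ γ)
    (hL : padicLFunctionMinusBranchMult f (1 : ℚ_[2]) 1 ≠ 0) : D.IsTorsion := by
  haveI : Fact (Nat.Prime 2) := ⟨Nat.prime_two⟩
  obtain ⟨D', -, -, -⟩ := Kato2004.selmerDualData_exists_involTwist (mul_inv_cancel γ) D
  exact selmerDualData_isTorsion_of_inv D'
    (isTorsion_selmerDualContra_of_splitTwistDescent hDesc W f κ γ hsp hκ hγ hγ5 hf I D' hL) D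

/-- Door-binder variant of `isTorsion_selmerDual_of_splitTwistDescent` (`L̃ = 2^m·L⁻ ≠ 0`).
[cite: Kato2004Asterisque, Thm. 17.4 (1) (p. 273), Thm. 16.2 (p. 269)] -/
theorem isTorsion_selmerDual_of_splitTwistDescent_of_doorMultiple
    (hDesc : Kato2004.exists_splitTwistDivisibilityInputsDescent_negOne_two)
    (W : WeierstrassCurve ℚ) [W.IsElliptic] [W.IsGloballyMinimal] [ContinuousSMul ℤ_[2] (W.tateModule 2)]
    {N : ℕ} [NeZero N] (f : CuspForm (Gamma0 N) 2) (κ : ZpExtension ℚ 2) (γ : absoluteGaloisGroup ℚ)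
    (hsp : (W.quadraticTwist (-1)).HasSplitMultiplicativeReductionAtPrime 2)
    (hκ : κ.IsCyclotomic) (hγ : κ.IsTopGenerator γ)
    (hγ5 : ((GaloisRep.cyclotomicCharacter ℚ 2 γ : ℤ_[2]ˣ) : ℤ_[2]) = (cyclotomicGenerator 2 : ℤ_[2]))
    (hf : IsNewformOf (W.quadraticTwist (-1)) f) (I : Kato2004.IwasawaH1Data W 2 κ γ)
    (D : W.SelmerDualData κ γ)
    (Lt : IwasawaAlgebra 2) (m : ℕ)
    (hLt : iwasawaToPowerSeries 2 Lt = PowerSeries.C ((2 : ℚ_[2]) ^ m) * padicLFunctionMinusBranchMult f (1 : ℚ_[2]) 1)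
    (hLt0 : Lt ≠ 0) : D.IsTorsion := by
  haveI : Fact (Nat.Prime 2) := ⟨Nat.prime_two⟩
  obtain ⟨D', -, -, -⟩ := Kato2004.selmerDualData_exists_involTwist (mul_inv_cancel γ) D
  exact selmerDualData_isTorsion_of_inv D'
    (isTorsion_selmerDualContra_of_splitTwistDescent_of_doorMultiple hDesc W f κ γ hsp hκ hγ hγ5 hf I D' Lt m hLt hLt0) D

/-- **`X(W₁/ℚ_∞)` is `Λ`-torsion for every `W₁ ∼_ℚ W`** (member form; `IsogenyMuShift.isTorsion_of_isIsogenous`). Twin of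
`isTorsion_selmerDual_of_oddBranchInputsPrintExactAnyImage_of_isIsogenous`.
[cite: Kato2004Asterisque, Thm. 17.4 (1) (p. 273), §8.3 (p. 181)] [cite: GreenbergVatsal2000, §2 (p. 28)] -/
theorem isTorsion_selmerDual_of_splitTwistDescent_of_isIsogenous
    (hDesc : Kato2004.exists_splitTwistDivisibilityInputsDescent_negOne_two)
    (W : WeierstrassCurve ℚ) [W.IsElliptic] [W.IsGloballyMinimal] [ContinuousSMul ℤ_[2] (W.tateModule 2)]
    {N : ℕ} [NeZero N] (f : CuspForm (Gamma0 N) 2) (κ : ZpExtension ℚ 2) (γ : absoluteGaloisGroup ℚ)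
    (hsp : (W.quadraticTwist (-1)).HasSplitMultiplicativeReductionAtPrime 2)
    (hκ : κ.IsCyclotomic) (hγ : κ.IsTopGenerator γ)
    (hγ5 : ((GaloisRep.cyclotomicCharacter ℚ 2 γ : ℤ_[2]ˣ) : ℤ_[2]) = (cyclotomicGenerator 2 : ℤ_[2]))
    (hf : IsNewformOf (W.quadraticTwist (-1)) f) (I : Kato2004.IwasawaH1Data W 2 κ γ)
    (hL : padicLFunctionMinusBranchMult f (1 : ℚ_[2]) 1 ≠ 0) (W₁ : WeierstrassCurve ℚ) [W₁.IsElliptic]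
    (hiso : IsIsogenous W W₁) (D₁ : W₁.SelmerDualData κ γ) : D₁.IsTorsion :=
  IsogenyMuShift.isTorsion_of_isIsogenous hiso (W.selmerDualData κ hγ) D₁
    (isTorsion_selmerDual_of_splitTwistDescent hDesc W f κ γ hsp hκ hγ hγ5 hf I (W.selmerDualData κ hγ) hL)


end Summit.BirchSwinnertonDyer.BirchSwinnertonDyer.Theorems.AddKatoTwo

end
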